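import Summits.KontsevichZagierPeriods.KontsevichZagierPeriods.Theorems.SoloInformedSmoothLeaf
import Summits.KontsevichZagierPeriods.KontsevichZagierPeriods.Theorems.SoloInformedLocalSide
import Summits.KontsevichZagierPeriods.KontsevichZagierPeriods.Theorems.SoloInformedAlgSplitZ
import Summits.KontsevichZagierPeriods.KontsevichZagierPeriods.Theorems.SoloInformedVolumeCube
import Mathlib.Analysis.Convex.Topology
import HarnessLib

/-!
# The leaf package: configurations without special points are presentable

Solo programme `solo-KontsevichZagierPeriods-informed`, session s111, PRES-RAT(2) step (γ-4).

A **leaf configuration** on the unit square is an open `ℚ`-semialgebraic `Ω ⊆ (0,1)²` whose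
frontier inside the open square lies on the zero set of a `K`-polynomial `F`, together with a
`K`-rational integrand `P/D`, such that at every point `z ∈ [0,1]² ∩ closure Ω` with `F(z) = 0`
one has `∇F(z) ≠ 0` and `D(z) ≠ 0`.  THEOREM LEAF (`soloInformed_presOn_of_leafCfg`): `P/D` is
presentable on `Ω`.  Proof: the LOCAL-GLOBAL principle; the three leaves are
* exterior points (`soloInformed_locPresOn_of_not_mem_closure`),
* closure points with `F ≠ 0`: the frontier misses a ball, so the (convex) trace of the ball on
  the open square lies in `Ω` and the cells there are full up to null edges
  (`soloInformed_locPresOn_of_ball_inter_openCube_subset`, THEOREM 2D⁺ restricted DOWN to a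
  co-null semialgebraic subset — `soloInformed_presOn_restrict`, valid for semialgebraic
  integrands since congruent representations are equivalent),
* closure points with `F = 0`: THE SMOOTH LEAF `soloInformed_locPresOn_smooth`.

References: M. Kontsevich, D. Zagier, *Periods* (2001), §1.2; J. Bochnak, M. Coste, M.-F. Roy,
*Real Algebraic Geometry* (1998), §2.
-/

noncomputable section

open scoped BigOperators Topology
open MeasureTheory Set Metric
open Literature.NumberTheory.Transcendental Literature.NumberTheory.Transcendental.KZ
open Literature.ModelTheory.ExponentialFields (IsSemialgebraic)

namespace Summit.KontsevichZagierPeriods.KontsevichZagierPeriods.Theorems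

variable {n : ℕ} {K : Type*} [Field K] [Algebra K ℝ]

/-! ### Restriction of presentability to a co-null subset -/

/-- **Restriction DOWN to a co-null subset.**  If `f` is `ℚ`-semialgebraic on the
`ℚ`-semialgebraic `Ω` and presentable on `Ω`, it is presentable on every `ℚ`-semialgebraic
`Ω' ⊆ Ω` with `Ω ∖ Ω'` null: a representation on `Ω'` extends by `f` to one on `Ω`. [this work] -/
theorem soloInformed_presOn_restrict {Ω Ω' : Set (Fin n → ℝ)} {f : (Fin n → ℝ) → ℝ}
    (hΩ : IsSemialgebraic ℚ Ω) (hΩ' : IsSemialgebraic ℚ Ω') (hsub : Ω' ⊆ Ω)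
    (hvol : volume (Ω \ Ω') = 0) (hf : IsSemialgebraicFunOn ℚ Ω f) (h : SoloInformedPresOn Ω f) :
    SoloInformedPresOn Ω' f := by
  intro r' hd' hi'
  have hint' : IntegrableOn f Ω' :=
    r'.integrableOn.congr_fun (fun x hx => hi' (hd' ▸ hx)) (hd' ▸ IsSemialgebraic.measurableSet_holds hΩ')
      |>.mono_set (by rw [hd'])
  have hint : IntegrableOn f Ω := by
    have h0 : IntegrableOn f (Ω \ Ω') := by
      rw [IntegrableOn, Measure.restrict_eq_zero.2 hvol]
      exact integrable_zero_measure
    have hu := hint'.union h0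
    exact hu.mono_set fun x hx => (em (x ∈ Ω')).elim Or.inl fun h' => Or.inr ⟨hx, h'⟩
  set r : IntegralRep n := ⟨Ω, f, hΩ, hf, hint⟩ with hr
  have hrp : of r ∈ soloInformedPresentable := h r rfl fun _ _ => rfl
  have h1 : of r - of (r.restrict Ω' hΩ' hsub) ∈ relations :=
    r.of_sub_of_restrict_mem_relations hΩ' hsub hvol
  have h2 : of (r.restrict Ω' hΩ' hsub) - of r' ∈ relations :=
    soloInformed_of_sub_of_mem_relations_of_eqOn _ _ (by rw [hd']; rfl)
      fun x hx => (hi' (by simpa using hx)).symm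
  have h3 : of r' - of r ∈ relations := by
    have h12 := relations.add_mem h1 h2
    rw [sub_add_sub_cancel] at h12
    simpa using relations.neg_mem h12
  exact soloInformed_presentable_of_sub_mem h3 hrp

/-! ### Full cells up to null edges -/

/-- A `K`-rational function (`K` as in THEOREM 2D⁺) is presentable on the trace of every grid
cell on the open square. [this work] -/
theorem soloInformed_presOn_openCube_inter_gridCell
    (hK : ∀ c : K, IsAlgebraic ℚ (algebraMap K ℝ c)) (hKrc : SoloInformedRealRootClosed K)
    {N : ℕ} (hN : 0 < N) (j : Fin 2 → Fin N) (P Q : MvPolynomial (Fin 2) K) :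
    SoloInformedPresOn (soloInformedOpenCube 2 ∩ soloInformedGridCell N j)
      (fun x => (MvPolynomial.aeval x P : ℝ) / MvPolynomial.aeval x Q) := by
  refine soloInformed_presOn_restrict (isSemialgebraic_soloInformedGridCell N j)
    ((isSemialgebraic_soloInformedOpenCube 2).inter (isSemialgebraic_soloInformedGridCell N j))
    inter_subset_right ?_
    (soloInformed_isSemialgebraicFunOn_aevalK_div₀ hK (isSemialgebraic_soloInformedGridCell N j) P Q)
    (soloInformed_presOn_gridCell_rational_dim2 hK hKrc hN j P Q)
  refine measure_mono_null (fun z hz => ?_) (soloInformed_volume_cube_diff_openCube 2)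
  exact ⟨soloInformedGridCell_subset_cube j hz.1, fun h => hz.2 ⟨h, hz.1⟩⟩

/-- **Leaf L-full.**  If `Ω ⊆ (0,1)²` contains the trace `B(p, ε) ∩ (0,1)²` of a ball, every
`K`-rational function is locally presentable on `Ω` at `p`. [this work] -/
theorem soloInformed_locPresOn_of_ball_inter_openCube_subset
    (hK : ∀ c : K, IsAlgebraic ℚ (algebraMap K ℝ c)) (hKrc : SoloInformedRealRootClosed K)
    (P Q : MvPolynomial (Fin 2) K) {Ω : Set (Fin 2 → ℝ)} (hΩc : Ω ⊆ soloInformedOpenCube 2)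
    {p : Fin 2 → ℝ} {ε : ℝ} (hε : 0 < ε) (hball : ball p ε ∩ soloInformedOpenCube 2 ⊆ Ω) :
    SoloInformedLocPresOn Ω (fun x => (MvPolynomial.aeval x P : ℝ) / MvPolynomial.aeval x Q) p := by
  refine ⟨ε, hε, fun N j hN hZ => ?_⟩
  have heq : Ω ∩ soloInformedGridCell N j = soloInformedOpenCube 2 ∩ soloInformedGridCell N j := by
    ext z
    exact ⟨fun hz => ⟨hΩc hz.1, hz.2⟩, fun hz => ⟨hball ⟨hZ hz.2, hz.1⟩, hz.2⟩⟩
  rw [heq]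
  exact soloInformed_presOn_openCube_inter_gridCell hK hKrc hN j P Q

/-! ### Exterior points and closure points off `Z(F)` -/

/-- **Leaf L-out.**  Local presentability at a point outside the closure. [this work] -/
theorem soloInformed_locPresOn_of_not_mem_closure {Ω : Set (Fin n → ℝ)} {f : (Fin n → ℝ) → ℝ}
    {p : Fin n → ℝ} (hp : p ∉ closure Ω) : SoloInformedLocPresOn Ω f p := by
  rw [Metric.mem_closure_iff] at hp
  push Not at hp
  obtain ⟨ε, hε, hfar⟩ := hp
  refine soloInformed_locPresOn_of_disjoint hε (Set.disjoint_left.2 fun z hz hzΩ => ?_)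
  exact (not_lt.2 (hfar z hzΩ)) (mem_ball'.1 hz)

/-- The open square is convex. -/
theorem soloInformed_convex_openCube (m : ℕ) : Convex ℝ (soloInformedOpenCube m) := by
  rw [soloInformedOpenCube_eq_pi]
  exact convex_pi fun _ _ => convex_Ioo 0 1

/-- **Closure points off the zero set are full.**  If `Ω ⊆ (0,1)²` is open with frontier
(inside the open square) on `Z(F)`, then at every `p ∈ closure Ω` with `F(p) ≠ 0` some trace
`B(p, ε) ∩ (0,1)²` lies in `Ω`. [this work] -/
theorem soloInformed_ball_inter_openCube_subset_of_aeval_ne (F : MvPolynomial (Fin 2) K)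
    {Ω : Set (Fin 2 → ℝ)} (hΩo : IsOpen Ω) (hΩc : Ω ⊆ soloInformedOpenCube 2)
    (hfr : ∀ z ∈ soloInformedOpenCube 2, z ∈ frontier Ω → (MvPolynomial.aeval z F : ℝ) = 0)
    {p : Fin 2 → ℝ} (hp : p ∈ closure Ω) (hF : (MvPolynomial.aeval p F : ℝ) ≠ 0) :
    ∃ ε > 0, ball p ε ∩ soloInformedOpenCube 2 ⊆ Ω := by
  have hcont : Continuous fun z : Fin 2 → ℝ => (MvPolynomial.aeval z F : ℝ) :=
    soloInformed_continuous_aevalK F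
  obtain ⟨ε, hε, hne⟩ : ∃ ε > 0, ∀ z ∈ ball p ε, (MvPolynomial.aeval z F : ℝ) ≠ 0 := by
    have hev := (hcont.continuousAt (x := p)).eventually_ne hF
    obtain ⟨ε, hε, h⟩ := Metric.eventually_nhds_iff.1 hev
    exact ⟨ε, hε, fun z hz => h (mem_ball.1 hz)⟩
  refine ⟨ε, hε, ?_⟩
  set W := ball p ε ∩ soloInformedOpenCube 2 with hW
  have hWc : IsPreconnected W :=
    ((convex_ball p ε).inter (soloInformed_convex_openCube 2)).isPreconnected
  have hdisj : Disjoint W (frontier Ω) :=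
    Set.disjoint_left.2 fun z hz hzf => hne z hz.1 (hfr z hz.2 hzf)
  rcases soloInformed_subset_or_disjoint_of_frontier hWc hΩo hdisj with h | h
  · exact h
  · exfalso
    obtain ⟨b, hb, hbd⟩ := Metric.mem_closure_iff.1 hp ε hε
    exact h.le_bot ⟨⟨mem_ball'.2 hbd, hΩc hb⟩, hb⟩

/-- **Leaf at a closure point off `Z(F)`**: local presentability of every `K`-rational function.
[this work] -/
theorem soloInformed_locPresOn_of_aeval_ne
    (hK : ∀ c : K, IsAlgebraic ℚ (algebraMap K ℝ c)) (hKrc : SoloInformedRealRootClosed K)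
    (P Q F : MvPolynomial (Fin 2) K) {Ω : Set (Fin 2 → ℝ)} (hΩo : IsOpen Ω)
    (hΩc : Ω ⊆ soloInformedOpenCube 2)
    (hfr : ∀ z ∈ soloInformedOpenCube 2, z ∈ frontier Ω → (MvPolynomial.aeval z F : ℝ) = 0)
    {p : Fin 2 → ℝ} (hp : p ∈ closure Ω) (hF : (MvPolynomial.aeval p F : ℝ) ≠ 0) :
    SoloInformedLocPresOn Ω (fun x => (MvPolynomial.aeval x P : ℝ) / MvPolynomial.aeval x Q) p := by
  obtain ⟨ε, hε, hball⟩ := soloInformed_ball_inter_openCube_subset_of_aeval_ne F hΩo hΩc hfr hp hF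
  exact soloInformed_locPresOn_of_ball_inter_openCube_subset hK hKrc P Q hΩc hε hball

/-! ### THEOREM LEAF -/

/-- **The leaf predicate**: every point `z ∈ [0,1]² ∩ closure Ω` with `F(z) = 0` is a smooth point
of `Z(F)` off the polar set of `D`. [this work] -/
def SoloInformedLeafCfg (F D : MvPolynomial (Fin 2) K) (Ω : Set (Fin 2 → ℝ)) : Prop :=
  ∀ z ∈ soloInformedCube 2, z ∈ closure Ω → (MvPolynomial.aeval z F : ℝ) = 0 →
    ((MvPolynomial.aeval z (MvPolynomial.pderiv 0 F) : ℝ) ≠ 0 ∨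
      (MvPolynomial.aeval z (MvPolynomial.pderiv 1 F) : ℝ) ≠ 0) ∧
    (MvPolynomial.aeval z D : ℝ) ≠ 0

/-- **THEOREM LEAF.**  Over a field `K` of real algebraic numbers closed under real roots, let
`Ω ⊆ (0,1)²` be open and `ℚ`-semialgebraic with frontier (inside the open square) on `Z(F)`, and
suppose every point of `[0,1]² ∩ closure Ω ∩ Z(F)` is a smooth point of `Z(F)` with `D ≠ 0`.
Then `P/D` is presentable on `Ω`. [this work] -/
theorem soloInformed_presOn_of_leafCfg [CharZero K]
    (hK : ∀ c : K, IsAlgebraic ℚ (algebraMap K ℝ c)) (hKrc : SoloInformedRealRootClosed K)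
    (P D F : MvPolynomial (Fin 2) K) {Ω : Set (Fin 2 → ℝ)} (hΩo : IsOpen Ω)
    (hΩ : IsSemialgebraic ℚ Ω) (hΩc : Ω ⊆ soloInformedOpenCube 2)
    (hfr : ∀ z ∈ soloInformedOpenCube 2, z ∈ frontier Ω → (MvPolynomial.aeval z F : ℝ) = 0)
    (hleaf : SoloInformedLeafCfg F D Ω) :
    SoloInformedPresOn Ω (fun x => (MvPolynomial.aeval x P : ℝ) / MvPolynomial.aeval x D) := by
  refine soloInformed_presOn_of_locally hΩ (hΩc.trans (soloInformedOpenCube_subset_cube 2))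
    fun p hp => ?_
  by_cases hcl : p ∈ closure Ω
  · by_cases hF : (MvPolynomial.aeval p F : ℝ) = 0
    · obtain ⟨hgrad, hDp⟩ := hleaf p hp hcl hF
      exact soloInformed_locPresOn_smooth hK hKrc P D F hΩo hΩ one_pos
        (fun z hz _ hzf => hfr z hz hzf) hF hgrad hDp
    · exact soloInformed_locPresOn_of_aeval_ne hK hKrc P D F hΩo hΩc hfr hcl hF
  · exact soloInformed_locPresOn_of_not_mem_closure hcl

/-! ### THEOREM LEAF on a grid cell (transport along the grid map) -/

omit [Algebra K ℝ] in
/-- The partial derivatives of a grid substitution: `∂ᵢ (Q ∘ Φ) = N⁻¹ · (∂ᵢ Q) ∘ Φ` for the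
grid move `Φ : xₗ ↦ (cₗ + xₗ)/N`. [this work] -/
theorem soloInformed_pderiv_gridSubstK (N : ℕ) (c : Fin n → ℕ) (i : Fin n)
    (Q : MvPolynomial (Fin n) K) :
    MvPolynomial.pderiv i (soloInformedGridSubstK Finset.univ N c Q) =
      MvPolynomial.C ((N : K)⁻¹) * soloInformedGridSubstK Finset.univ N c
        (MvPolynomial.pderiv i Q) := by
  classical
  induction Q using MvPolynomial.induction_on with
  | C a =>
    simp only [soloInformedGridSubstK, MvPolynomial.bind₁_C_right, MvPolynomial.pderiv_C,
      map_zero, mul_zero]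
  | add p q hp hq => simp only [map_add, hp, hq, mul_add]
  | mul_X p l ih =>
    have hX : soloInformedGridSubstK Finset.univ N c (MvPolynomial.X l : MvPolynomial (Fin n) K) =
        MvPolynomial.C ((c l : K) / N) + MvPolynomial.C ((N : K)⁻¹) * MvPolynomial.X l := by
      simp only [soloInformedGridSubstK, MvPolynomial.bind₁_X_right, Finset.mem_univ, if_true]
    rw [map_mul (soloInformedGridSubstK _ _ _), MvPolynomial.pderiv_mul, ih, MvPolynomial.pderiv_mul,
      map_add, map_mul (soloInformedGridSubstK _ _ _), map_mul (soloInformedGridSubstK _ _ _), hX]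
    simp only [map_add, MvPolynomial.pderiv_C, MvPolynomial.pderiv_C_mul, MvPolynomial.pderiv_X,
      zero_add]
    by_cases hli : l = i
    · subst hli
      simp only [Pi.single_eq_same, map_one]
      ring
    · simp only [Pi.single_eq_of_ne hli, map_zero, mul_zero]
      ring

/-- **THEOREM LEAF on a grid cell.**  Under the hypotheses of THEOREM LEAF restricted to the
points of a closed grid cell `Z` — every point of `Z ∩ closure Ω ∩ Z(F)` is smooth with `D ≠ 0` —
`P/D` is presentable on `Ω ∩ Z`: transport along the grid map and THEOREM LEAF for the
transported configuration. [this work] -/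
theorem soloInformed_presOn_inter_gridCell_of_leafCfg [CharZero K]
    (hK : ∀ c : K, IsAlgebraic ℚ (algebraMap K ℝ c)) (hKrc : SoloInformedRealRootClosed K)
    (P D F : MvPolynomial (Fin 2) K) {Ω : Set (Fin 2 → ℝ)} (hΩo : IsOpen Ω)
    (hΩ : IsSemialgebraic ℚ Ω)
    (hfr : ∀ z ∈ soloInformedOpenCube 2, z ∈ frontier Ω → (MvPolynomial.aeval z F : ℝ) = 0)
    {N : ℕ} (hN : 0 < N) (j : Fin 2 → Fin N)
    (hleaf : ∀ z ∈ soloInformedGridCell N j, z ∈ closure Ω → (MvPolynomial.aeval z F : ℝ) = 0 →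
      ((MvPolynomial.aeval z (MvPolynomial.pderiv 0 F) : ℝ) ≠ 0 ∨
        (MvPolynomial.aeval z (MvPolynomial.pderiv 1 F) : ℝ) ≠ 0) ∧
      (MvPolynomial.aeval z D : ℝ) ≠ 0) :
    SoloInformedPresOn (Ω ∩ soloInformedGridCell N j)
      (fun x => (MvPolynomial.aeval x P : ℝ) / MvPolynomial.aeval x D) := by
  have hNr : (0 : ℝ) < N := by exact_mod_cast hN
  set Φ := soloInformedGridMap N j with hΦ_def
  set c : Fin 2 → ℕ := fun l => (j l : ℕ) with hc
  have hmove : ∀ x : Fin 2 → ℝ, soloInformedGridMoveR Finset.univ N c x = Φ x := fun x => by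
    rw [soloInformed_gridMoveR_univ]; rfl
  have hsub : ∀ (Q : MvPolynomial (Fin 2) K) (x : Fin 2 → ℝ),
      (MvPolynomial.aeval x (soloInformedGridSubstK Finset.univ N c Q) : ℝ) =
        MvPolynomial.aeval (Φ x) Q := fun Q x => by
    rw [soloInformed_aeval_gridSubstK, hmove]
  have hΦo : ∀ z ∈ soloInformedOpenCube 2, Φ z ∈ soloInformedOpenCube 2 := fun z hz l => by
    have hl := hz l
    have hjl : ((j l : ℕ) : ℝ) + 1 ≤ N := by exact_mod_cast (j l).isLt
    have hj0 : (0 : ℝ) ≤ ((j l : ℕ) : ℝ) := by positivity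
    simp only [hΦ_def, soloInformedGridMap_apply]
    exact ⟨div_pos (by linarith [hl.1]) hNr, by rw [div_lt_one hNr]; linarith [hl.2]⟩
  have hΦZ : ∀ z ∈ soloInformedCube 2, Φ z ∈ soloInformedGridCell N j := fun z hz => by
    rw [← soloInformed_image_gridMap_cube hN j]
    exact mem_image_of_mem _ hz
  -- the transported configuration
  set Ω' : Set (Fin 2 → ℝ) := Φ ⁻¹' Ω ∩ soloInformedOpenCube 2 with hΩ'_def
  have hpre : IsSemialgebraic ℚ (Φ ⁻¹' Ω) := soloInformed_isSemialgebraic_preimage_gridMap hΩ N j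
  have hΩ'o : IsOpen Ω' :=
    (hΩo.preimage (soloInformed_continuous_gridMap N j)).inter (soloInformed_isOpen_openCube 2)
  have hΩ' : IsSemialgebraic ℚ Ω' := hpre.inter (isSemialgebraic_soloInformedOpenCube 2)
  have hΩ'c : Ω' ⊆ soloInformedOpenCube 2 := inter_subset_right
  have hcl : ∀ z ∈ closure Ω', Φ z ∈ closure Ω := fun z hz =>
    (soloInformed_continuous_gridMap N j).closure_preimage_subset Ω
      (closure_mono inter_subset_left hz)
  set F' := soloInformedGridSubstK Finset.univ N c F with hF'
  set D' := soloInformedGridSubstK Finset.univ N c D with hD'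
  set P' := MvPolynomial.C (((N : K)⁻¹) ^ 2) * soloInformedGridSubstK Finset.univ N c P with hP'
  have hfr' : ∀ z ∈ soloInformedOpenCube 2, z ∈ frontier Ω' →
      (MvPolynomial.aeval z F' : ℝ) = 0 := by
    intro z hz hzf
    have hzf1 : z ∈ frontier (Φ ⁻¹' Ω) := by
      refine ⟨closure_mono inter_subset_left hzf.1, fun hzi => hzf.2 ?_⟩
      rw [interior_inter, (soloInformed_isOpen_openCube 2).interior_eq]
      exact ⟨hzi, hz⟩
    have hzf' : Φ z ∈ frontier Ω :=
      (soloInformed_continuous_gridMap N j).frontier_preimage_subset Ω hzf1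
    rw [hF', hsub]
    exact hfr _ (hΦo z hz) hzf'
  have hleaf' : SoloInformedLeafCfg F' D' Ω' := by
    intro z hz hzc hzF
    rw [hF', hsub] at hzF
    obtain ⟨hgrad, hDz⟩ := hleaf (Φ z) (hΦZ z hz) (hcl z hzc) hzF
    refine ⟨?_, by rw [hD', hsub]; exact hDz⟩
    have hder : ∀ i : Fin 2, (MvPolynomial.aeval z (MvPolynomial.pderiv i F') : ℝ) =
        (N : ℝ)⁻¹ * MvPolynomial.aeval (Φ z) (MvPolynomial.pderiv i F) := fun i => by
      rw [hF', soloInformed_pderiv_gridSubstK, map_mul, MvPolynomial.aeval_C, hsub, map_inv₀,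
        map_natCast]
    have hN0 : (N : ℝ)⁻¹ ≠ 0 := inv_ne_zero hNr.ne'
    rcases hgrad with h | h
    · exact Or.inl (by rw [hder]; exact mul_ne_zero hN0 h)
    · exact Or.inr (by rw [hder]; exact mul_ne_zero hN0 h)
  have hleafP := soloInformed_presOn_of_leafCfg hK hKrc P' D' F' hΩ'o hΩ' hΩ'c hfr' hleaf'
  -- back along the grid map
  refine soloInformed_presOn_inter_gridCell_of_pullback hΩ hN j ?_
  refine soloInformed_presOn_of_subset_null hΩ' (inter_subset_inter_right _
    (soloInformedOpenCube_subset_cube 2)) (measure_mono_null (fun z hz => ?_)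
    (soloInformed_volume_cube_diff_openCube 2)) ?_
  · exact ⟨hz.1.2, fun h => hz.2 ⟨hz.1.1, h⟩⟩
  · refine (soloInformed_presOn_congr fun x _ => ?_).1 hleafP
    show (MvPolynomial.aeval x P' : ℝ) / MvPolynomial.aeval x D' =
      MvPolynomial.aeval (Φ x) P / MvPolynomial.aeval (Φ x) D * ((N : ℝ)⁻¹) ^ 2
    rw [hP', hD', map_mul, MvPolynomial.aeval_C, hsub, hsub, map_pow, map_inv₀, map_natCast]
    ring

end Summit.KontsevichZagierPeriods.KontsevichZagierPeriods.Theorems
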